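import Summits.ResolutionOfSingularities.ResolutionOfSingularities.Theses.FrobeniusClosing
import Summits.ResolutionOfSingularities.ResolutionOfSingularities.Theorems.ClosingReduction.Negative.DimensionOne

/-!
# Disproof of `BoundedMilnor` — findings (cdisprove seat, 2026-08-17)

Crux: `Summit.ResolutionOfSingularities.ResolutionOfSingularities.Theses.FrobeniusClosing.BoundedMilnor`
(stmt-ResolutionOfSingularities-16346).  Verdict of this cycle: **no kill is possible for p ≥ 3 — the
hypothesis `∀ m, Isol (run m) ∧ MultP (run m)` has no model there** (paper proof `PROOF-T.md` in the crux
directory, Steps 1–6; numerically corroborated with the literal dynamics, `toy/checks.py`, 300 random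
states, 0 violations).  Equivalently the route TARGET `IsolatedForcedTermination` holds for every prime
p ≥ 3 by an elementary argument (order stays p; centres are vertices of the tangent form; the rank of the
tangent form never drops; vertex space of dimension ≥ 3 makes the blown-up point non-isolated; dimension 1
frees all later centres, which puts them on a smooth formal arc Γ with a ∈ I_Γ^p, non-isolated; dimension 2
dies within two steps by an (α, β) coefficient dichotomy).  For p = 2 one regime (rank n−2, all-satellite
alternating centres) is not excluded by that bookkeeping; the earlier refuter pass argues finiteness there
too (sketch).  So:

* `BoundedMilnor` is (for p ≥ 3 provably, for p = 2 conjecturally) **vacuously true**; it cannot be refuted.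
* Load-bearing analysis: dropping `Isol` does not produce a false statement either (`Module.finrank` of a
  non-finite module is `0`, so the conclusion becomes trivial); dropping `MultP` changes the dynamics to
  `s = 0` steps, under which `∀ m, Isol` again fails after two steps (total transform of an order-≥-2 germ is
  divisible by y², so J ⊆ (y)).  `PerfectField`, `CharP`, `p.Prime`, `0 < n` are not load-bearing for truth
  (n = 0: `clean ≡ 0`, `MultP` false; n = 1: the order drops by p each step).  Hence there is no honest
  `_false_without_` lemma to land for this crux: every single-hypothesis weakening stays true.
* Natural strengthenings: a bound β uniform in (c₀, i, t) — equally vacuous.  The only substantive content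
  in the vicinity is the sibling crux `JacobianBudget.IsolatedJacobianDrop` (finite chains), where the
  (3,3) experiment `toy/eternal33.py` shows μ dropping by exactly 12 ≥ Δ₃(3) = 11 per forced isolated step
  on chains pinned to survive k steps (μ₀ ≈ 14 + 12k): consistent, no counterexample.
* Small models tried (all consistent with vacuity): n ≤ 3 all p (paper); (p,n) = (3,4) toric/satellite
  chains (exponent bookkeeping: every S_y⁺S_w pattern kills MultP or the isolatedness); (3,3) "eternal MultP"
  families (pins kill exactly the isolating monomials); formalisation junk (`tr` truncation, `dv` drop,
  `sInf ∅`, `0^0`, cleaning placement) — the lets are faithful, no misstatement to exploit.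

Lean content: (1) the vacuity structure itself — the crux is implied by the target;
(2) the n = 1 shadow of the main finding — the crux hypothesis is empty in dimension one (here derived
from the sibling lane's `isolatedForcedTermination_dim_one`; a self-contained and slightly stronger
version, `noMultPRun_dim_one` — `MultP` alone already has no run — is filed as
`Theorems/BoundedMilnor/Negative/DimensionOne.lean`, proposal p173726).
Used from the sibling disprover's files (`Theorems/ClosingReduction/Negative/*`): `_false_without_Isol`
(the non-isolated atom z² = u₀u₁² is an eternal MultP run — consistent with §5 of PROOF-T.md: it lies in
I_Γ^p for Γ = the u₀-axis), `_false_without_MultP`, `isolatedForcedTermination_dim_one`.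
-/

set_option linter.dupNamespace false -- mandated namespace of this single-conjunct summit

namespace Summit.ResolutionOfSingularities.ResolutionOfSingularities.Cruxes.BoundedMilnor.Disproof

open Summit.ResolutionOfSingularities.ResolutionOfSingularities.Theses.FrobeniusClosing

/-- Vacuity structure of the crux: `BoundedMilnor`'s hypothesis is literally the negation of the
conclusion of the route target `IsolatedForcedTermination` (same binders, same thirteen `let`s), so the
target implies the crux outright.  Combined with `PROOF-T.md` (target true for p ≥ 3) this is why no
refutation of `BoundedMilnor` can exist at odd p. -/
theorem boundedMilnor_of_isolatedForcedTermination :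
    IsolatedForcedTermination → BoundedMilnor := by
  intro hT p hp n hn κ _ _ _ c₀ i t clean bl ord dv tr step run ser pd jac Isol MultP mu h
  exact absurd h (hT p hp n hn κ c₀ i t)

/-- **Dimension one is empty for the crux hypothesis** (`n := 1`, route telescope verbatim): there is
no run with `Isol ∧ MultP` at every step, so `BoundedMilnor` is vacuously true at `n = 1`.  Derived from
the sibling lane's `isolatedForcedTermination_dim_one`; the `MultP`-only strengthening is
`Theorems/BoundedMilnor/Negative/DimensionOne.lean` (`noMultPRun_dim_one`, p173726). -/
theorem hypothesis_empty_dim_one (p : ℕ) (hp : p.Prime) (κ : Type) [Field κ] [CharP κ p]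
    [PerfectField κ] (c₀ : (Fin 1 → ℕ) → κ) (i : ℕ → Fin 1) (t : ℕ → Fin 1 → κ) :
    let clean : ((Fin 1 → ℕ) → κ) → ((Fin 1 → ℕ) → κ) := fun c A => @ite κ (∀ j, p ∣ A j) (Classical.dec _) 0 (c A); let bl : Fin 1 → ((Fin 1 → ℕ) → κ) → ((Fin 1 → ℕ) → κ) := fun i c B => @ite κ (Finset.sum (Finset.univ.erase i) (fun j => B j) ≤ B i) (Classical.dec _) (c (Function.update B i (B i - Finset.sum (Finset.univ.erase i) (fun j => B j)))) 0; let ord : ((Fin 1 → ℕ) → κ) → ℕ := fun c => sInf {m : ℕ | ∃ A, c A ≠ 0 ∧ m = Finset.sum Finset.univ (fun j => A j)}; let dv : Fin 1 → ℕ → ((Fin 1 → ℕ) → κ) → ((Fin 1 → ℕ) → κ) := fun i s c B => c (Function.update B i (B i + s)); let tr : Fin 1 → (Fin 1 → κ) → ℕ → ((Fin 1 → ℕ) → κ) → ((Fin 1 → ℕ) → κ) := fun i τ s c B => Finset.sum (Fintype.piFinset (fun _ : Fin 1 => Finset.range (B i + s + 1))) (fun D => @ite κ (D i = 0) (Classical.dec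 _) (c (B + D) * Finset.prod (Finset.univ.erase i) (fun j => ((Nat.choose (B j + D j) (B j) : ℕ) : κ) * τ j ^ (D j))) 0); let step : Fin 1 → (Fin 1 → κ) → ((Fin 1 → ℕ) → κ) → ((Fin 1 → ℕ) → κ) := fun i τ c => clean (tr i τ (@ite ℕ (p ≤ ord (clean c)) (Classical.dec _) p 0) (dv i (@ite ℕ (p ≤ ord (clean c)) (Classical.dec _) p 0) (bl i (clean c)))); let run : ((Fin 1 → ℕ) → κ) → (ℕ → Fin 1) → (ℕ → Fin 1 → κ) → ℕ → ((Fin 1 → ℕ) → κ) := fun c₀ i t m => @Nat.rec (fun _ => (Fin 1 → ℕ) → κ) c₀ (fun m c => step (i m) (t m) c) m; let ser : ((Fin 1 → ℕ) → κ) → MvPowerSeries (Fin 1) κ := fun c => show MvPowerSeries (Fin 1) κ from fun A : Fin 1 →₀ ℕ => clean c ⇑A; let pd : Fin 1 → MvPowerSeries (Fin 1) κ → MvPowerSeries (Fin 1) κ := fun i f => show MvPowerSeries (Fin 1) κ from fun A : Fin 1 →₀ ℕ => ((A i + 1 : ℕ) : κ) * f (A + Finsupp.single i 1); let jac : ((Fin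 1 → ℕ) → κ) → Ideal (MvPowerSeries (Fin 1) κ) := fun c => Ideal.span (Set.range (fun i => pd i (ser c))); let Isol : ((Fin 1 → ℕ) → κ) → Prop := fun c => Module.Finite κ (MvPowerSeries (Fin 1) κ ⧸ jac c); let MultP : ((Fin 1 → ℕ) → κ) → Prop := fun c => (∃ A, clean c A ≠ 0) ∧ ∀ A, clean c A ≠ 0 → p ≤ Finset.sum Finset.univ (fun j => A j); 
    ¬ (∀ m, Isol (run c₀ i t m) ∧ MultP (run c₀ i t m)) :=
  Summit.ResolutionOfSingularities.ResolutionOfSingularities.Theorems.ClosingReduction.Negative.isolatedForcedTermination_dim_one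
    p hp κ c₀ i t

/-- **`BoundedMilnor` at `n = 1` holds (vacuously)** — the `n = 1` instance of the crux body. -/
theorem boundedMilnor_dim_one (p : ℕ) (hp : p.Prime) (κ : Type) [Field κ] [CharP κ p]
    [PerfectField κ] (c₀ : (Fin 1 → ℕ) → κ) (i : ℕ → Fin 1) (t : ℕ → Fin 1 → κ) :
    let clean : ((Fin 1 → ℕ) → κ) → ((Fin 1 → ℕ) → κ) := fun c A => @ite κ (∀ j, p ∣ A j) (Classical.dec _) 0 (c A); let bl : Fin 1 → ((Fin 1 → ℕ) → κ) → ((Fin 1 → ℕ) → κ) := fun i c B => @ite κ (Finset.sum (Finset.univ.erase i) (fun j => B j) ≤ B i) (Classical.dec _) (c (Function.update B i (B i - Finset.sum (Finset.univ.erase i) (fun j => B j)))) 0; let ord : ((Fin 1 → ℕ) → κ) → ℕ := fun c => sInf {m : ℕ | ∃ A, c A ≠ 0 ∧ m = Finset.sum Finset.univ (fun j => A j)}; let dv : Fin 1 → ℕ → ((Fin 1 → ℕ) → κ) → ((Fin 1 → ℕ) → κ) := fun i s c B => c (Function.update B i (B i + s)); let tr : Fin 1 → (Fin 1 → κ) →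 ℕ → ((Fin 1 → ℕ) → κ) → ((Fin 1 → ℕ) → κ) := fun i τ s c B => Finset.sum (Fintype.piFinset (fun _ : Fin 1 => Finset.range (B i + s + 1))) (fun D => @ite κ (D i = 0) (Classical.dec _) (c (B + D) * Finset.prod (Finset.univ.erase i) (fun j => ((Nat.choose (B j + D j) (B j) : ℕ) : κ) * τ j ^ (D j))) 0); let step : Fin 1 → (Fin 1 → κ) → ((Fin 1 → ℕ) → κ) → ((Fin 1 → ℕ) → κ) := fun i τ c => clean (tr i τ (@ite ℕ (p ≤ ord (clean c)) (Classical.dec _) p 0) (dv i (@ite ℕ (p ≤ ord (clean c)) (Classical.dec _) p 0) (bl i (clean c)))); let run : ((Fin 1 → ℕ) → κ) → (ℕ → Fin 1) → (ℕ → Fin 1 → κ) → ℕ → ((Fin 1 → ℕ) → κ) := fun c₀ i t m => @Nat.rec (fun _ => (Fin 1 → ℕ) → κ) c₀ (fun m c => step (i m) (t m) c) m; let ser : ((Fin 1 → ℕ) → κ) → MvPowerSeries (Fin 1) κ := fun c => show MvPowerSeries (Fin 1) κ from fun A : Fin 1 →₀ ℕ => clean c ⇑A; let pd : Fin 1 →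 MvPowerSeries (Fin 1) κ → MvPowerSeries (Fin 1) κ := fun i f => show MvPowerSeries (Fin 1) κ from fun A : Fin 1 →₀ ℕ => ((A i + 1 : ℕ) : κ) * f (A + Finsupp.single i 1); let jac : ((Fin 1 → ℕ) → κ) → Ideal (MvPowerSeries (Fin 1) κ) := fun c => Ideal.span (Set.range (fun i => pd i (ser c))); let Isol : ((Fin 1 → ℕ) → κ) → Prop := fun c => Module.Finite κ (MvPowerSeries (Fin 1) κ ⧸ jac c); let MultP : ((Fin 1 → ℕ) → κ) → Prop := fun c => (∃ A, clean c A ≠ 0) ∧ ∀ A, clean c A ≠ 0 → p ≤ Finset.sum Finset.univ (fun j => A j); 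
    let mu : ((Fin 1 → ℕ) → κ) → ℕ := fun c => Module.finrank κ (MvPowerSeries (Fin 1) κ ⧸ jac c);
    (∀ m, Isol (run c₀ i t m) ∧ MultP (run c₀ i t m)) → ∃ β : ℕ, ∀ m, mu (run c₀ i t m) ≤ β := by
  intro clean bl ord dv tr step run ser pd jac Isol MultP mu h
  exact absurd h (hypothesis_empty_dim_one p hp κ c₀ i t)

end Summit.ResolutionOfSingularities.ResolutionOfSingularities.Cruxes.BoundedMilnor.Disproof
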